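import Mathlib
import Summits.ResolutionOfSingularities.ResolutionOfSingularities.Theorems.WeightedInvariantLocalWeightedDropTOT2CurveSwap

/-!
# `LocalWeightedDrop`, NC count game — TOT2-LINE piece S-CRV (v1.3 (P3)/(B3)): `u₂`-GRAPHS UNDER THE AXIS-CURVE MOVES — F4 and F6 conjugated by
# the swap

[OURS · L1 W4.3 · chain w43, engine crux `LocalWeightedDrop` stmt-ResolutionOfSingularities-8899; piece S-CRV / (P3) = res-type-088; `--supports 8899 --as helper`,
counted 0; definition-free; nothing here is a statement of any manuscript; AI-written (gate-accepted = sorry-free with standard axioms, not refereed).]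

With `Â = (j ↦ A_j(u₂,u₁))` (`subst ![X 1, X 0]`): `(divOneT d A)^ = divTwoT d Â` and `(divTwoT d A)^ = divOneT d Â` (`swap_divOneT`, `swap_divTwoT`).
Hence the `u₂`-graphs of `A` (= `u₁`-graphs of `Â`) obey, under the axis-curve moves of succT, the conjugates of F4/F6:
* **`graph_swap_divOneT`** (F6^) — if `V(y,u₁)` is permissible for the position `A` and `Â` carries a graph branch with datum `g ≠ 0` (a `u₂`-graph of
  `A` other than the centre), then `(divOneT d A)^` carries it with the SAME datum: a `u₂`-graph tangent to `V(u₁)` keeps its contact with the new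
  boundary letter `u₁` — the `u₂`-side twin of the conflict birth of `…TOT2CurveConflictBirthExample`;
* **`graph_swap_divTwoT`** (F4^) — if `V(y,u₂)` is permissible for `A`, every `u₂`-graph survives `divTwoT` with the same datum.
-/

set_option linter.dupNamespace false -- mandated namespace of this single-conjunct summit

noncomputable section

namespace Summit.ResolutionOfSingularities.ResolutionOfSingularities.Theorems

namespace TOT2Curve

open MvPowerSeries PolyDescent MonicDescent WildMonic Literature.AlgebraicGeometry.Resolution

variable {k : Type} [Field k] {d : ℕ}

/-- `(divTwoT d A)^ = divOneT d Â`. -/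
theorem swap_divTwoT (A : Fin d → MvPowerSeries (Fin 2) k) :
    (fun j => subst (![X 1, X 0] : Fin 2 → MvPowerSeries (Fin 2) k) (divTwoT d A j)) =
      divOneT d (fun i => subst (![X 1, X 0] : Fin 2 → MvPowerSeries (Fin 2) k) (A i)) := by
  funext j
  rw [divTwoT_eq_swap]
  exact subst_swap_subst_swap _

/-- `(divOneT d A)^ = divTwoT d Â`. -/
theorem swap_divOneT (A : Fin d → MvPowerSeries (Fin 2) k) :
    (fun j => subst (![X 1, X 0] : Fin 2 → MvPowerSeries (Fin 2) k) (divOneT d A j)) =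
      divTwoT d (fun i => subst (![X 1, X 0] : Fin 2 → MvPowerSeries (Fin 2) k) (A i)) := by
  rw [divTwoT_eq_swap]
  funext j
  simp only [subst_swap_subst_swap]

/-- **(F6^) `u₂`-GRAPHS SURVIVE THE `V(y,u₁)`-MOVE.**  If `V(y,u₁)` is permissible for the position `A` and the swapped label carries a permissible graph
branch with `u₂`-free datum `g ≠ 0`, then the swapped label of `divOneT d A` carries a permissible graph branch with the same datum `g`. -/
theorem graph_swap_divOneT (hd : 0 < d) (A : Fin d → MvPowerSeries (Fin 2) k) (hA : IsPosT d A) (hA1 : IsPermissibleOneT d A)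
    (g ψ : MvPowerSeries (Fin 2) k) (hg : ∀ e : Fin 2 →₀ ℕ, e 1 ≠ 0 → coeff e g = 0) (hg0 : g ≠ 0)
    (hperm : IsPermissibleTwoT d (shift d (shearT g (fun i => subst (![X 1, X 0] : Fin 2 → MvPowerSeries (Fin 2) k) (A i))) ψ)) :
    ∃ ψ' : MvPowerSeries (Fin 2) k, constantCoeff ψ' = 0 ∧
      IsPermissibleTwoT d (shift d (shearT g (fun j => subst (![X 1, X 0] : Fin 2 → MvPowerSeries (Fin 2) k) (divOneT d A j))) ψ') := by
  rw [swap_divOneT]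
  exact graph_divTwoT hd _ ((isPosT_swap_iff A).mpr hA) ((isPermissibleTwoT_swap_iff A).mpr hA1) g ψ hg hg0 hperm

/-- **(F4^) `u₂`-GRAPHS SURVIVE THE `V(y,u₂)`-MOVE.**  If `V(y,u₂)` is permissible for the position `A` and the swapped label carries a permissible graph
branch with datum `g` (re-centring `ψ`, `ψ(0) = 0`), then the swapped label of `divTwoT d A` carries it with the same datum. -/
theorem graph_swap_divTwoT (hd : 0 < d) (A : Fin d → MvPowerSeries (Fin 2) k) (hA : IsPosT d A) (hA2 : IsPermissibleTwoT d A)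
    (g ψ : MvPowerSeries (Fin 2) k) (hψ : constantCoeff ψ = 0)
    (hperm : IsPermissibleTwoT d (shift d (shearT g (fun i => subst (![X 1, X 0] : Fin 2 → MvPowerSeries (Fin 2) k) (A i))) ψ)) :
    ∃ ψ' : MvPowerSeries (Fin 2) k, constantCoeff ψ' = 0 ∧
      IsPermissibleTwoT d (shift d (shearT g (fun j => subst (![X 1, X 0] : Fin 2 → MvPowerSeries (Fin 2) k) (divTwoT d A j))) ψ') := by
  rw [swap_divTwoT]
  exact graph_divOneT hd _ ((isPosT_swap_iff A).mpr hA) ((isPermissibleOneT_swap_iff A).mpr hA2) g ψ hψ hperm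

end TOT2Curve

end Summit.ResolutionOfSingularities.ResolutionOfSingularities.Theorems

end
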